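/-
Copyright: rh-split cell (screw, prover seat l22) gen 0, 2026-08-27.  D-0145 line L23
(route-RiemannHypothesis-ScrewExcursionDoor, desk rh-idea-9).  The door below is a DETECTION theorem
(hypotheses about `ζ`'s own screw function imply quasi-RH); the route's residual `ExcursionResidual`
is RH-equivalent by declaration.  Nothing here bears on the truth of RH.
-/
import Literature.NumberTheory.LFunctions.ZetaScrewThm17Proofs
import Summits.RiemannHypothesis.RiemannHypothesis.Theses.ScrewExcursionDoor

/-!
# `ScrewExcursionDoor.ExcursionDoor` (stmt-RiemannHypothesis-22184) — PROVED: the RH-free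
# measure-graded Landau door

`Ψ = zetaScrew` (Suzuki2023 (1.1)).  Main results:

* `perturbedLandau` — ROBUST LANDAU DETECTION WITH A SLACK FUNCTION (the analytic heart; the tree's
  `IntegerScrewDiscreteLandau.robustLandau` is the constant slack `D ≡ K`): if `D` is measurable,
  `β ≥ 0`, `∫_0^∞ D(t) e^{-βt} dt < ∞` and `Ψ(t) ≥ -D(t)` for `t ≥ 0`, then `ξ(1/2 + w) ≠ 0` for
  `Re w > β`.  Proof (MontgomeryVaughan2007 Lemma 15.1 = tree
  `Landau.integrableOn_of_differentiableOn_union_convex`, run on `g(x) = Ψ(log x) + D(log x) ≥ 0`):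
  the transform of `g` on `Re s > 1` is `R(s) + L_D(s)` with `R(s) = s^{-2}(ξ'/ξ)(1/2+s)`
  (Suzuki2023 Thm 1.1 (1), tree `mellinIoi_eq_of_re_gt`) and `L_D` holomorphic on `Re s > β`
  (`Landau.differentiableOn_mellinIoi_of_forall`); `R` is holomorphic off the zeros of `ξ(1/2+·)`
  and `s = 0`, in particular on a thin rectangle around the real segment `[ε₁, 3]`, `ε₁ > β`; Landau
  pushes the abscissa of `g` — hence of `Ψ∘log` — below every `ε > β`, and the identity-theorem /
  order-of-vanishing argument of `ZetaScrewThm17Proofs` (verbatim) excludes a zero `w₀`, `Re w₀ > ε`.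
* `excursionDoor` — the door in unfolded form: for `η > 0`, `θ, σ₀ < η`, integrability on `[0,∞)`
  of `(−Ψ(t) − e^{θt})⁺ e^{−σ₀t}` gives `QuasiRiemannHypothesis (1/2 + η)`: the slack
  `D = (−Ψ − e^{θt})⁺ + e^{θt} ≥ -Ψ` is of Laplace class `β = (max(θ,σ₀,0) + η)/2 < η`.
* `excursionDoor_proof : Theses.ScrewExcursionDoor.ExcursionDoor` — the route decl, closed BY NAME.

Axioms: propext, Classical.choice, Quot.sound.  Nothing here bears on the truth of RH.
-/

noncomputable section

open Complex Filter Topology Set MeasureTheory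

namespace Summit.RiemannHypothesis.RiemannHypothesis.Theorems.ScrewExcursionDoorExcursionDoor

open Literature.NumberTheory.LFunctions
open Literature.NumberTheory.LFunctions.ZetaScrewLandau

/-! ## The slack function in the Mellin variable -/

/-- `D(log x) x^{-(σ+1)} ∈ L¹(1,∞)` iff `D(t) e^{-σt} ∈ L¹(0,∞)` (substitution `x = e^t`). -/
theorem integrableOn_log_rpow_iff (D : ℝ → ℝ) (σ : ℝ) :
    IntegrableOn (fun x : ℝ ↦ D (Real.log x) * x ^ (-(σ + 1))) (Ioi 1) ↔
      IntegrableOn (fun t : ℝ ↦ D t * Real.exp (-σ * t)) (Ioi 0) := by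
  rw [integrableOn_Ioi_one_iff]
  refine integrableOn_congr_fun (fun t _ ↦ ?_) measurableSet_Ioi
  rw [smul_eq_mul, Real.log_exp, Real.rpow_def_of_pos (Real.exp_pos t), Real.log_exp]
  have : Real.exp t * Real.exp (t * -(σ + 1)) = Real.exp (-σ * t) := by
    rw [← Real.exp_add]
    congr 1
    ring
  rw [← this]
  ring

/-! ## Robust Landau detection with a slack function -/

/-- **Robust Landau detection with a slack function of Laplace class `β`.** If `D : ℝ → ℝ` is
measurable, `β ≥ 0`, `D(t) e^{-βt}` is integrable on `(0, ∞)` and `Ψ(t) ≥ -D(t)` for all `t ≥ 0`,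
then `ξ(1/2 + w₀) ≠ 0` for every `Re w₀ > β` (MontgomeryVaughan2007 Lemma 15.1 applied to the
non-negative `g(x) = Ψ(log x) + D(log x)`, whose transform is `s^{-2}(ξ'/ξ)(1/2+s) + L_D(s)` with
`L_D` holomorphic on `Re s > β`; Suzuki2023 Thm 1.1 (1), §7.2). -/
theorem perturbedLandau {D : ℝ → ℝ} (hDm : Measurable D) {β : ℝ} (hβ : 0 ≤ β)
    (hDint : IntegrableOn (fun t : ℝ ↦ D t * Real.exp (-β * t)) (Ioi 0))
    (hΨD : ∀ t : ℝ, 0 ≤ t → -D t ≤ zetaScrew t) :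
    ∀ w₀ : ℂ, β < w₀.re → riemannXi (1 / 2 + w₀) ≠ 0 := by
  intro w₀ hw₀ hzero
  -- zeros of `ξ(1/2 + ·)` have real part `< 1/2`
  have hw₀' : w₀.re < 1 / 2 := by
    by_contra h
    exact riemannXi_ne_zero_of_one_le_re (by simp; linarith) hzero
  have hβ1 : β < 1 / 2 := lt_trans hw₀ hw₀'
  have hg₀ : Measurable (fun x : ℝ ↦ zetaScrew (Real.log x)) :=
    continuous_zetaScrew.measurable.comp Real.measurable_log
  have hD₀ : Measurable (fun x : ℝ ↦ D (Real.log x)) := hDm.comp Real.measurable_log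
  have hg : Measurable (fun x : ℝ ↦ zetaScrew (Real.log x) + D (Real.log x)) := hg₀.add hD₀
  -- the slack's Mellin integrand converges absolutely at every `σ ≥ β`
  have hDσ : ∀ σ : ℝ, β ≤ σ →
      IntegrableOn (fun x : ℝ ↦ D (Real.log x) * x ^ (-(σ + 1))) (Ioi 1) :=
    fun σ hσ ↦ Landau.integrableOn_rpow_of_le hD₀ hσ ((integrableOn_log_rpow_iff D β).2 hDint)
  set R : ℂ → ℂ := fun s ↦ 1 / s ^ 2 * logDeriv riemannXi (1 / 2 + s) with hR_def
  set L : ℂ → ℂ := Landau.mellinIoi (fun x : ℝ ↦ D (Real.log x)) with hL_def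
  set Φ : ℂ → ℂ := fun s ↦ R s + L s with hΦ_def
  have hLd : DifferentiableOn ℂ L {s : ℂ | β < s.re} :=
    Landau.differentiableOn_mellinIoi_of_forall hD₀ fun σ' hσ' ↦ hDσ σ' hσ'.le
  set ε : ℝ := (β + w₀.re) / 2 with hε_def
  have hβε : β < ε := by rw [hε_def]; linarith
  have hεw : ε < w₀.re := by rw [hε_def]; linarith
  have hε1 : ε < 1 := by linarith
  set ε₁ : ℝ := (β + ε) / 2 with hε₁_def
  have hβε₁ : β < ε₁ := by rw [hε₁_def]; linarith
  have hε₁ε : ε₁ < ε := by rw [hε₁_def]; linarith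
  -- a zero-free thin rectangle around the real segment `[ε₁, 3]`
  set Kc : Set ℂ := (fun σ : ℝ ↦ (σ : ℂ)) '' Icc ε₁ 3 with hKc_def
  have hKcc : IsCompact Kc := (isCompact_Icc.image Complex.continuous_ofReal)
  set U : Set ℂ := {s : ℂ | riemannXi (1 / 2 + s) ≠ 0} with hU_def
  have hUo : IsOpen U := by
    have : U = (fun s : ℂ ↦ riemannXi (1 / 2 + s)) ⁻¹' {0}ᶜ := rfl
    rw [this]
    exact isOpen_compl_singleton.preimage (differentiable_riemannXi.continuous.comp (by fun_prop))
  have hKU : Kc ⊆ U := by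
    rintro _ ⟨σ, _, rfl⟩
    exact riemannXi_half_add_ofReal_ne_zero σ
  obtain ⟨d₀, hd₀, hthick⟩ := hKcc.exists_thickening_subset_open hUo hKU
  set W₀ : Set ℂ := {s : ℂ | ε₁ < s.re ∧ s.re < 3 ∧ -d₀ < s.im ∧ s.im < d₀} with hW₀_def
  have hW₀eq : W₀ = {s : ℂ | ε₁ < s.re} ∩ ({s : ℂ | s.re < 3} ∩ ({s : ℂ | -d₀ < s.im} ∩
      {s : ℂ | s.im < d₀})) := by
    ext s; simp [hW₀_def]
  have hW₀o : IsOpen W₀ := by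
    rw [hW₀eq]
    exact (isOpen_lt continuous_const Complex.continuous_re).inter
      ((isOpen_lt Complex.continuous_re continuous_const).inter
        ((isOpen_lt continuous_const Complex.continuous_im).inter
          (isOpen_lt Complex.continuous_im continuous_const)))
  have hW₀c : Convex ℝ W₀ := by
    rw [hW₀eq]
    exact (convex_halfSpace_re_gt _).inter ((convex_halfSpace_re_lt _).inter
      ((convex_halfSpace_im_gt _).inter (convex_halfSpace_im_lt _)))
  have hW₀U : W₀ ⊆ U := by
    intro s hs
    refine hthick (Metric.mem_thickening_iff.2 ⟨(s.re : ℂ), ⟨s.re, ⟨hs.1.le, hs.2.1.le⟩, rfl⟩, ?_⟩)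
    rw [dist_eq_norm]
    have : s - (s.re : ℂ) = (s.im : ℂ) * I := by
      apply Complex.ext <;> simp
    rw [this, norm_mul, Complex.norm_I, mul_one, Complex.norm_real, Real.norm_eq_abs, abs_lt]
    exact ⟨hs.2.2.1, hs.2.2.2⟩
  have hW₀r : ∀ σ : ℝ, ε < σ → σ ≤ 1 + 1 → (σ : ℂ) ∈ W₀ := by
    intro σ h1 h2
    simp only [hW₀_def, Set.mem_setOf_eq, ofReal_re, ofReal_im, neg_lt_zero]
    exact ⟨by linarith, by linarith, hd₀, hd₀⟩
  -- `Φ = R + L_D` is holomorphic on `{Re s > 1} ∪ W₀` (both lie in `Re s > β`, away from `0`)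
  have hΦd : DifferentiableOn ℂ Φ ({s : ℂ | 1 < s.re} ∪ W₀) := by
    intro s hs
    have hsβ : β < s.re := by
      rcases hs with hs | hs
      · simp only [Set.mem_setOf_eq] at hs; linarith
      · exact lt_trans hβε₁ hs.1
    have hs0 : s ≠ 0 := by
      intro h0
      rw [h0, zero_re] at hsβ
      linarith
    have hξ : riemannXi (1 / 2 + s) ≠ 0 := by
      rcases hs with hs | hs
      · exact riemannXi_ne_zero_of_one_le_re (by simp only [Set.mem_setOf_eq] at hs; simp; linarith)
      · exact hW₀U hs
    have h1 : DifferentiableAt ℂ R s := differentiableAt_R hs0 hξ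
    have h2 : DifferentiableAt ℂ L s :=
      (hLd s hsβ).differentiableAt ((Landau.isOpen_re_gt β).mem_nhds hsβ)
    exact (h1.add h2).differentiableWithinAt
  -- and agrees with the transform of `g = Ψ∘log + D∘log` on `Re s > 1`
  have hagree : EqOn Φ (Landau.mellinIoi (fun x : ℝ ↦ zetaScrew (Real.log x) + D (Real.log x)))
      {s : ℂ | 1 < s.re} := by
    intro s hs
    simp only [Set.mem_setOf_eq] at hs
    have hΨint : Integrable (fun x : ℝ ↦ ((zetaScrew (Real.log x) : ℝ) : ℂ) * (x : ℂ) ^ (-(s + 1)))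
        (volume.restrict (Ioi 1)) := by
      have h := Landau.integrable_mellinIntegrand hg₀
        (integrableOn_zetaScrew_log_rpow (σ := 1) (by norm_num)) 0 (s := s) hs
      refine h.congr (Eventually.of_forall fun x ↦ ?_)
      simp [Landau.mellinIntegrand]
    have hDint' : Integrable (fun x : ℝ ↦ ((D (Real.log x) : ℝ) : ℂ) * (x : ℂ) ^ (-(s + 1)))
        (volume.restrict (Ioi 1)) := by
      have h := Landau.integrable_mellinIntegrand hD₀ (hDσ β le_rfl) 0 (s := s) (by linarith)
      refine h.congr (Eventually.of_forall fun x ↦ ?_)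
      simp [Landau.mellinIntegrand]
    have hR : R s = Landau.mellinIoi (fun x : ℝ ↦ zetaScrew (Real.log x)) s :=
      (mellinIoi_eq_of_re_gt (by linarith)).symm
    symm
    calc Landau.mellinIoi (fun x : ℝ ↦ zetaScrew (Real.log x) + D (Real.log x)) s
        = ∫ x in Ioi (1 : ℝ), (((zetaScrew (Real.log x) : ℝ) : ℂ) * (x : ℂ) ^ (-(s + 1))
            + ((D (Real.log x) : ℝ) : ℂ) * (x : ℂ) ^ (-(s + 1))) := by
          unfold Landau.mellinIoi
          refine setIntegral_congr_fun measurableSet_Ioi fun x _ ↦ ?_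
          push_cast
          ring
      _ = Landau.mellinIoi (fun x : ℝ ↦ zetaScrew (Real.log x)) s + L s := by
          rw [integral_add hΨint hDint']
          rfl
      _ = Φ s := by rw [← hR]
  -- Landau for the non-negative `g`: absolute convergence for every `σ > ε`
  have hint : IntegrableOn (fun x : ℝ ↦ (zetaScrew (Real.log x) + D (Real.log x)) * x ^ (-((1 : ℝ) + 1)))
      (Ioi 1) := by
    have h1 := integrableOn_zetaScrew_log_rpow (σ := 1) (by norm_num)
    have h2 := hDσ 1 (by linarith)
    refine (h1.add h2).congr_fun (fun x _ ↦ ?_) measurableSet_Ioi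
    simp only [Pi.add_apply]
    ring
  have hpos : ∀ x : ℝ, 1 < x → 0 ≤ zetaScrew (Real.log x) + D (Real.log x) := by
    intro x hx
    have := hΨD (Real.log x) (Real.log_pos hx).le
    linarith
  have hS' : ∀ σ' : ℝ, ε < σ' →
      IntegrableOn (fun x : ℝ ↦ (zetaScrew (Real.log x) + D (Real.log x)) * x ^ (-(σ' + 1)))
        (Ioi 1) :=
    fun σ' hσ' ↦ Landau.integrableOn_of_differentiableOn_union_convex hg hint le_rfl hpos
      hε1 hW₀o hW₀c hW₀r hΦd hagree hσ'
  -- hence for `Ψ∘log` itself (the slack term is integrable for `σ' > ε > β`)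
  have hS : ∀ σ' : ℝ, ε < σ' →
      IntegrableOn (fun x : ℝ ↦ zetaScrew (Real.log x) * x ^ (-(σ' + 1))) (Ioi 1) := by
    intro σ' hσ'
    refine ((hS' σ' hσ').sub (hDσ σ' (by linarith))).congr_fun (fun x _ ↦ ?_) measurableSet_Ioi
    simp only [Pi.sub_apply]
    ring
  -- from here on verbatim the tree: holomorphy of `F` on `Re s > ε`, identity theorem, orders
  set F : ℂ → ℂ := Landau.mellinIoi (fun x : ℝ ↦ zetaScrew (Real.log x)) with hF_def
  have hFdiff : DifferentiableOn ℂ F {s : ℂ | ε < s.re} :=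
    Landau.differentiableOn_mellinIoi_of_forall hg₀ hS
  have hFR : EqOn F R {s : ℂ | 1 < s.re} := by
    intro s hs
    simp only [Set.mem_setOf_eq] at hs
    exact mellinIoi_eq_of_re_gt (by linarith)
  set H : Set ℂ := {s : ℂ | ε < s.re} with hH_def
  have hHo : IsOpen H := isOpen_lt continuous_const Complex.continuous_re
  have hHpre : IsPreconnected H := (convex_halfSpace_re_gt ε).isPreconnected
  set Z : ℂ → ℂ := fun s ↦ riemannXi (1 / 2 + s) with hZ_def
  have hZd : Differentiable ℂ Z := differentiable_riemannXi.comp (by fun_prop)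
  have hZa : ∀ s, AnalyticAt ℂ Z s := fun s ↦ hZd.analyticAt s
  have hderivZ : ∀ s, deriv Z s = deriv riemannXi (1 / 2 + s) := fun s ↦ by
    simp only [hZ_def]
    exact deriv_comp_const_add riemannXi (1 / 2) s
  set G : ℂ → ℂ := fun s ↦ F s * s ^ 2 with hG_def
  have hGa : ∀ s ∈ H, AnalyticAt ℂ G s := fun s hs ↦
    ((hFdiff.analyticOnNhd hHo) s hs).mul ((analyticAt_id.pow 2))
  have hf₁ : AnalyticOnNhd ℂ (G * Z) H := fun s hs ↦ (hGa s hs).mul (hZa s)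
  have hf₂ : AnalyticOnNhd ℂ (deriv Z) H := fun s _ ↦ (hZa s).deriv
  have h2H : (2 : ℂ) ∈ H := by simp [hH_def]; linarith
  have hev2 : (G * Z) =ᶠ[𝓝 (2 : ℂ)] deriv Z := by
    have hopen : IsOpen {s : ℂ | 1 < s.re} := isOpen_lt continuous_const Complex.continuous_re
    filter_upwards [hopen.mem_nhds (show (2 : ℂ) ∈ {s : ℂ | 1 < s.re} by simp)] with s hs
    have hs' : 1 < s.re := hs
    have hξ : riemannXi (1 / 2 + s) ≠ 0 := riemannXi_ne_zero_of_one_le_re (by simp; linarith)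
    have hs0 : s ≠ 0 := fun h ↦ by rw [h, zero_re] at hs'; linarith
    rw [Pi.mul_apply, hderivZ s]
    simp only [hG_def, hZ_def]
    rw [hFR hs]
    simp only [hR_def]
    rw [logDeriv_apply]
    set A : ℂ := deriv riemannXi (1 / 2 + s)
    set B : ℂ := riemannXi (1 / 2 + s)
    field_simp
  have hEqOn : EqOn (G * Z) (deriv Z) H := hf₁.eqOn_of_preconnected_of_eventuallyEq hf₂ hHpre h2H hev2
  -- orders at `w₀`
  have hw₀H : w₀ ∈ H := by simp [hH_def]; linarith
  have hev : deriv Z =ᶠ[𝓝 w₀] G * Z := by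
    filter_upwards [hHo.mem_nhds hw₀H] with s hs
    exact (hEqOn hs).symm
  have hZ0 : Z w₀ = 0 := hzero
  have h1 : analyticOrderAt (deriv Z) w₀ + 1 = analyticOrderAt Z w₀ := by
    have := (hZa w₀).analyticOrderAt_deriv_add_one
    simpa [hZ0] using this
  have h2 : analyticOrderAt (deriv Z) w₀ = analyticOrderAt G w₀ + analyticOrderAt Z w₀ := by
    rw [analyticOrderAt_congr hev, analyticOrderAt_mul (hGa w₀ hw₀H) (hZa w₀)]
  rw [h2] at h1
  -- `Z` is not locally zero (else `ξ ≡ 0`), so its order is finite, contradiction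
  generalize hoZ : analyticOrderAt Z w₀ = oZ at h1
  generalize hoG : analyticOrderAt G w₀ = oG at h1
  cases oZ with
  | top =>
    have hloc : ∀ᶠ s in 𝓝 w₀, Z s = 0 := analyticOrderAt_eq_top.1 hoZ
    have hall : EqOn Z 0 univ :=
      (hZd.differentiableOn.analyticOnNhd isOpen_univ).eqOn_zero_of_preconnected_of_eventuallyEq_zero
        isPreconnected_univ (Set.mem_univ w₀) hloc
    have h1' : Z 1 = 0 := hall (Set.mem_univ 1)
    simp only [hZ_def] at h1'
    exact riemannXi_ne_zero_of_one_le_re (s := 1 / 2 + 1) (by norm_num) h1'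
  | coe n =>
    cases oG with
    | top => simp at h1
    | coe m =>
      have h' : (m + n + 1 : ℕ) = n := by exact_mod_cast h1
      omega

/-! ## The door -/

/-- **RH-free measure-graded Landau door** (`ScrewExcursionDoor.ExcursionDoor`,
stmt-RiemannHypothesis-22184, in unfolded form): for `η > 0` and `θ, σ₀ < η`, if the `θ`-deficit
`(−Ψ(t) − e^{θt})⁺` of `Ψ` has finite `e^{−σ₀t}`-Laplace mass on `[0, ∞)`, then `ζ` has no zero
with `1/2 + η < Re s < 1`.  Proof: the slack `D = (−Ψ − e^{θt})⁺ + e^{θt}` satisfies `Ψ ≥ -D` on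
`[0,∞)` and is of Laplace class `β = (max(θ, σ₀, 0) + η)/2 ∈ [0, η)`; apply `perturbedLandau` and
the `ξ ↔ ζ` zero dictionary (`riemannXi_eq_zero_iff_holds`).  A detection theorem; nothing here
bears on the truth of RH. -/
theorem excursionDoor (η : ℝ) (hη : 0 < η) (θ σ₀ : ℝ) (hθ : θ < η) (hσ₀ : σ₀ < η)
    (hI : IntegrableOn (fun t : ℝ => max (-zetaScrew t - Real.exp (θ * t)) 0 * Real.exp (-(σ₀ * t)))
      (Ici 0)) :
    QuasiRiemannHypothesis (1 / 2 + η) := by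
  set m : ℝ := max θ (max σ₀ 0) with hm
  have hmη : m < η := max_lt hθ (max_lt hσ₀ hη)
  set β : ℝ := (m + η) / 2 with hβdef
  have hβm : m < β := by rw [hβdef]; linarith
  have hβη : β < η := by rw [hβdef]; linarith
  have hθβ : θ < β := lt_of_le_of_lt (le_max_left _ _) hβm
  have hσ₀β : σ₀ < β := lt_of_le_of_lt ((le_max_left _ _).trans (le_max_right θ _)) hβm
  have hβ0 : 0 ≤ β := ((le_max_right _ _).trans (le_max_right θ _)).trans hβm.le
  set D : ℝ → ℝ := fun t => max (-zetaScrew t - Real.exp (θ * t)) 0 + Real.exp (θ * t) with hD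
  have hdc : Continuous fun t : ℝ => max (-zetaScrew t - Real.exp (θ * t)) 0 :=
    (continuous_zetaScrew.neg.sub (Real.continuous_exp.comp (continuous_const.mul continuous_id))).max
      continuous_const
  have hDc : Continuous D :=
    hdc.add (Real.continuous_exp.comp (continuous_const.mul continuous_id))
  have hΨD : ∀ t : ℝ, 0 ≤ t → -D t ≤ zetaScrew t := by
    intro t _
    simp only [hD]
    rcases le_or_gt (-zetaScrew t - Real.exp (θ * t)) 0 with h | h
    · rw [max_eq_right h]; linarith
    · rw [max_eq_left h.le]; linarith
  have hDint : IntegrableOn (fun t : ℝ ↦ D t * Real.exp (-β * t)) (Ioi 0) := by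
    have hI' : IntegrableOn (fun t : ℝ => max (-zetaScrew t - Real.exp (θ * t)) 0
        * Real.exp (-(σ₀ * t))) (Ioi 0) := hI.mono_set Ioi_subset_Ici_self
    have h1 : IntegrableOn (fun t : ℝ => max (-zetaScrew t - Real.exp (θ * t)) 0
        * Real.exp (-β * t)) (Ioi 0) := by
      refine Integrable.mono' hI'
        ((hdc.mul (Real.continuous_exp.comp (continuous_const.mul continuous_id))).aestronglyMeasurable)
        ?_
      rw [ae_restrict_iff' measurableSet_Ioi]
      refine Eventually.of_forall fun t (ht : 0 < t) ↦ ?_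
      have hd0 : 0 ≤ max (-zetaScrew t - Real.exp (θ * t)) 0 := le_max_right _ _
      rw [Real.norm_eq_abs, abs_of_nonneg (mul_nonneg hd0 (Real.exp_pos _).le)]
      refine mul_le_mul_of_nonneg_left (Real.exp_le_exp.2 ?_) hd0
      nlinarith
    have h2 : IntegrableOn (fun t : ℝ => Real.exp ((θ - β) * t)) (Ioi 0) :=
      integrableOn_exp_mul_Ioi (by linarith) 0
    refine (h1.add h2).congr_fun (fun t _ ↦ ?_) measurableSet_Ioi
    simp only [hD, Pi.add_apply]
    rw [add_mul, ← Real.exp_add]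
    congr 2
    ring
  have hL := perturbedLandau hDc.measurable hβ0 hDint hΨD
  intro s hs h1 h2
  have hξ : riemannXi s = 0 := (riemannXi_eq_zero_iff_holds s).2 ⟨hs, by linarith, h2⟩
  have hw : β < (s - 1 / 2).re := by simp; linarith
  refine hL (s - 1 / 2) hw ?_
  rw [show (1 / 2 : ℂ) + (s - 1 / 2) = s by ring]
  exact hξ

/-- **Crux `ScrewExcursionDoor.ExcursionDoor` (stmt-RiemannHypothesis-22184) closed BY NAME**: the
route decl, unfolded, is `excursionDoor` token for token.  A detection theorem; nothing here bears
on the truth of RH. -/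
theorem excursionDoor_proof :
    Summit.RiemannHypothesis.RiemannHypothesis.Theses.ScrewExcursionDoor.ExcursionDoor := by
  unfold Summit.RiemannHypothesis.RiemannHypothesis.Theses.ScrewExcursionDoor.ExcursionDoor
  intro η hη θ σ₀ hθ hσ₀ hI
  exact excursionDoor η hη θ σ₀ hθ hσ₀ hI

end Summit.RiemannHypothesis.RiemannHypothesis.Theorems.ScrewExcursionDoorExcursionDoor

end
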